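/-
COR-CM (cell pub-hodgecm2, stage 2 of the Hodge ladder) — count-neutral KERNEL COMBINATORICS «the sheared dihedral family», part IV: the dihedral and
abelian index-two cores (seat prover-pub-hodgecm2-b23-g52-0, binder prover b23, gen 52; claim «SYLOW TRANSFER XII + THE SHEARED DIHEDRAL FAMILY»,
HOME/INBOX.md l.23708).  Theorems only, on part I (`Census/ShearedDihedralDatum.lean`) and gen 48ʼs `Dihedral.Datum` (`Census/DihedralDatum.lean`)
BY NAME; no definition (the cores are the Mathlib terms `Subgroup.closure {g, x}`, `Subgroup.closure {g, s}`, `Subgroup.closure {g, s·x}`), no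
`decide`, no certificate, no named fact, no `sorry`; `Interfaces.lean` (C1), every E term, B01, `Transposition/*`, `PortJoin/*`, `D2Bridge/*` untouched.
HONEST FRAMING: `HC_CM` is NOT proved, here or anywhere in the tree; nothing here is a period, a count of record or a headline.
T5: n/a-class (hypothesis binders = the fields of `ShearedDihedral.Datum`; checker: self).
-/
import Summits.HodgeConjecture.CorCM.Census.ShearedDihedralDatum

/-!
# The sheared dihedral family, IV: the three index-two cores `⟨g, x⟩ ≅ D(ℤ/2n)`, `⟨g, s⟩ ≅ ℤ/2n × ℤ/2`, `⟨g, sx⟩ ≅ Dic_n`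

For a sheared dihedral datum `D` on `(G, c)` (`G ≅ G_n`, part I) the three subgroups of index two containing the rotations `⟨g⟩` are read off the
normal form `gⁱ sʲ xᵉ`; each is the input of one of seat b23 gen 46ʼs split index-two routes (`Census/IndexTwoSplit*`, `hodgeSpan_le_of_rep_checklist`:
`H` of index two, `c ∈ H`, an involution outside `H`):
* §1 **THE DIHEDRAL CORE `K_x = ⟨g, x⟩`** (`Subgroup.closure {g, x}`): elements `gⁱ xᵉ` (`mem_closure_gx_iff`), order `4n`, index `2`, `c ∈ K_x`,
  `s ∉ K_x` (the involution `s` outside acts as the SHEAR); **`nonempty_dihedralDatum`**: `K_x` carries gen 48ʼs `Dihedral.Datum` at level `n` with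
  central rotation `c` — so gen 48ʼs DIHEDRAL LAW gives `μ(K_x, c) = β(K_x, c) − 2` generating faces to lift.
* §2 **THE ABELIAN CORE `K_s = ⟨g, s⟩`** (`Subgroup.closure {g, s}`): elements `gⁱ sʲ`, order `4n`, index `2`, commutative, `c ∈ K_s`, `x ∉ K_s`
  (the involution `x` outside acts by `(a, b) ↦ (−a + nb, b)`).
* the DICYCLIC CORE `⟨g, sx⟩ ≅ Dic_n` is the sequel `Census/ShearedDihedralCoreDicyclic.lean`.
Numerics (part I docstring): over each core gen 46ʼs checklist realises `μ(G_n) = β − 2` for `n = 2, 3`; over the dihedral core all closing faces sit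
at the base diagonal type.

## References
* [Pohlmann1968] H. Pohlmann, Algebraic cycles on abelian varieties of complex multiplication type, Ann. of Math. 88 (1968), Thm 1.
* [Milne1999] J. S. Milne, Lefschetz motives and the Tate conjecture, Compositio Math. 117 (1999), Prop. 2.1, p. 54.
-/

namespace Summit.HodgeConjecture.CorCM.Census.ShearedDihedral

open Finset

noncomputable section

variable {G : Type*} [Group G] [Fintype G] [DecidableEq G] {c : G} {n : ℕ}
variable (D : Datum G c n)

namespace Datum

include D

/-! ## §0 Integer powers -/

omit [Fintype G] [DecidableEq G] in
/-- `x gᶻ = g⁻ᶻ x` for `z : ℤ`. [folklore] -/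
theorem x_mul_zpow (z : ℤ) : D.x * D.g ^ z = D.g ^ (-z) * D.x := by
  have h : D.x * D.g ^ z * D.x⁻¹ = D.g ^ (-z) := by
    rw [← MulAut.conj_apply, map_zpow, MulAut.conj_apply, D.hxg, inv_zpow, zpow_neg]
  rw [← h, inv_mul_cancel_right]

omit [Fintype G] [DecidableEq G] in
/-- `xᵉ gᶻ = g^{±z} xᵉ` (`e < 2`). [folklore] -/
theorem xpow_mul_zpow {e : ℕ} (he : e < 2) (z : ℤ) : ∃ z' : ℤ, D.x ^ e * D.g ^ z = D.g ^ z' * D.x ^ e := by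
  interval_cases e
  · exact ⟨z, by rw [pow_zero, one_mul, mul_one]⟩
  · exact ⟨-z, by rw [pow_one, D.x_mul_zpow]⟩

omit [Fintype G] [DecidableEq G] in
/-- `xᵉ xᶠ = x^{(e+f) % 2}`. [folklore] -/
theorem xpow_mul_xpow (e f : ℕ) : D.x ^ e * D.x ^ f = D.x ^ ((e + f) % 2) := by
  rw [← pow_add]
  conv_lhs => rw [← Nat.div_add_mod (e + f) 2, pow_add, pow_mul, pow_two, D.hx2, one_pow, one_mul]

omit [DecidableEq G] in
/-- An integer power of `g` is a natural power below `2n`. [folklore] -/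
theorem exists_pow_eq_zpow (z : ℤ) : ∃ i : ℕ, i < 2 * n ∧ D.g ^ i = D.g ^ z := by
  obtain ⟨i, hi, h⟩ := IndexTwoCyclic.exists_pow_eq_of_mem_zpowers (Subgroup.zpow_mem _ (Subgroup.mem_zpowers D.g) z)
  exact ⟨i, D.hord ▸ hi, h⟩

/-! ## §1 The dihedral core `⟨g, x⟩` -/

omit [DecidableEq G] in
/-- **Membership in the dihedral core**: `y ∈ ⟨g, x⟩ ↔ y = gⁱ xᵉ` (`i < 2n`, `e < 2`). [folklore] -/
theorem mem_closure_gx_iff (y : G) :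
    y ∈ Subgroup.closure ({D.g, D.x} : Set G) ↔ ∃ i : ℕ, i < 2 * n ∧ ∃ e : ℕ, e < 2 ∧ y = D.g ^ i * D.x ^ e := by
  constructor
  · intro hy
    -- the set of `gᶻ xᵉ` is a subgroup containing `g` and `x`
    let K : Subgroup G :=
      { carrier := {y | ∃ z : ℤ, ∃ e : ℕ, e < 2 ∧ y = D.g ^ z * D.x ^ e}
        one_mem' := ⟨0, 0, by norm_num, by rw [zpow_zero, pow_zero, mul_one]⟩
        mul_mem' := by
          rintro _ _ ⟨z₁, e₁, he₁, rfl⟩ ⟨z₂, e₂, he₂, rfl⟩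
          obtain ⟨z', hz'⟩ := D.xpow_mul_zpow he₁ z₂
          refine ⟨z₁ + z', (e₁ + e₂) % 2, Nat.mod_lt _ two_pos, ?_⟩
          rw [mul_assoc, ← mul_assoc (D.x ^ e₁), hz', mul_assoc, D.xpow_mul_xpow, ← mul_assoc, ← zpow_add]
        inv_mem' := by
          rintro _ ⟨z, e, he, rfl⟩
          obtain rfl | rfl : e = 0 ∨ e = 1 := by omega
          · exact ⟨-z, 0, by norm_num, by rw [pow_zero, mul_one, mul_one, zpow_neg]⟩
          · refine ⟨z, 1, by norm_num, ?_⟩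
            rw [pow_one, mul_inv_rev, inv_eq_of_mul_eq_one_right D.hx2, ← zpow_neg, D.x_mul_zpow, neg_neg] }
    have hle : Subgroup.closure ({D.g, D.x} : Set G) ≤ K := by
      rw [Subgroup.closure_le]
      rintro y (rfl | rfl)
      · exact ⟨1, 0, by norm_num, by rw [zpow_one, pow_zero, mul_one]⟩
      · exact ⟨0, 1, by norm_num, by rw [zpow_zero, pow_one, one_mul]⟩
    obtain ⟨z, e, he, rfl⟩ := hle hy
    obtain ⟨i, hi, h⟩ := D.exists_pow_eq_zpow z
    exact ⟨i, hi, e, he, by rw [h]⟩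
  · rintro ⟨i, -, e, -, rfl⟩
    exact mul_mem (Subgroup.pow_mem _ (Subgroup.subset_closure (by simp)) i)
      (Subgroup.pow_mem _ (Subgroup.subset_closure (by simp)) e)

/-- **`|⟨g, x⟩| = 4n`.** [folklore] -/
theorem card_closure_gx : Nat.card (Subgroup.closure ({D.g, D.x} : Set G)) = 4 * n := by
  classical
  set K := Subgroup.closure ({D.g, D.x} : Set G)
  let f : Fin (2 * n) × Fin 2 → G := fun t => D.g ^ (t.1 : ℕ) * D.x ^ (t.2 : ℕ)
  have hinj : Function.Injective f := by
    rintro ⟨i, e⟩ ⟨i', e'⟩ h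
    have h' : D.g ^ (i : ℕ) * D.s ^ 0 * D.x ^ (e : ℕ) = D.g ^ (i' : ℕ) * D.s ^ 0 * D.x ^ (e' : ℕ) := by
      simpa only [pow_zero, mul_one] using h
    obtain ⟨h1, -, h3⟩ := D.normalForm_inj i.2 i'.2 (by norm_num) (by norm_num) e.2 e'.2 h'
    ext <;> simp only [h1, h3]
  have himg : Finset.univ.filter (fun y : G => y ∈ K) = Finset.univ.image f := by
    ext y
    simp only [Finset.mem_filter, Finset.mem_univ, true_and, Finset.mem_image]
    rw [D.mem_closure_gx_iff]
    constructor
    · rintro ⟨i, hi, e, he, rfl⟩; exact ⟨(⟨i, hi⟩, ⟨e, he⟩), rfl⟩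
    · rintro ⟨⟨i, e⟩, rfl⟩; exact ⟨i, i.2, e, e.2, rfl⟩
  rw [Nat.card_eq_fintype_card, Fintype.card_subtype, himg, Finset.card_image_of_injective _ hinj, Finset.card_univ,
    Fintype.card_prod, Fintype.card_fin, Fintype.card_fin]
  ring

/-- **`⟨g, x⟩` has index two.** [folklore] -/
theorem index_closure_gx : (Subgroup.closure ({D.g, D.x} : Set G)).index = 2 := by
  have h := (Subgroup.closure ({D.g, D.x} : Set G)).card_mul_index
  rw [D.card_closure_gx, D.hcard] at h
  have hn := D.card_eq_eight_mul
  have : 4 * n * (Subgroup.closure ({D.g, D.x} : Set G)).index = 4 * n * 2 := by rw [h]; ring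
  refine Nat.eq_of_mul_eq_mul_left ?_ this
  have := Fintype.card_pos (α := G)
  omega

omit [Fintype G] [DecidableEq G] in
/-- `c ∈ ⟨g, x⟩`. [folklore] -/
theorem c_mem_closure_gx : c ∈ Subgroup.closure ({D.g, D.x} : Set G) := by
  have h : D.g ^ n ∈ Subgroup.closure ({D.g, D.x} : Set G) := Subgroup.pow_mem _ (Subgroup.subset_closure (by simp)) n
  rwa [D.hgn] at h

omit [DecidableEq G] in
/-- **`s ∉ ⟨g, x⟩`** (nor `gⁱ sˢ xᵉ` with `sʲ = s`). [folklore] -/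
theorem s_notMem_closure_gx : D.s ∉ Subgroup.closure ({D.g, D.x} : Set G) := by
  rw [D.mem_closure_gx_iff]
  rintro ⟨i, hi, e, he, h⟩
  have h' : D.g ^ 0 * D.s ^ 1 * D.x ^ 0 = D.g ^ i * D.s ^ 0 * D.x ^ e := by
    simpa only [pow_zero, pow_one, one_mul, mul_one] using h
  have hn : 0 < 2 * n := by omega
  obtain ⟨-, h2, -⟩ := D.normalForm_inj hn hi (by norm_num) (by norm_num) (by norm_num) he h'
  exact absurd h2 (by norm_num)

omit [DecidableEq G] in
/-- `gⁱ s xᵉ ∉ ⟨g, x⟩`: the coset of `s`. [folklore] -/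
theorem pow_mul_s_mul_xpow_notMem_closure_gx (i e : ℕ) : D.g ^ i * D.s * D.x ^ e ∉ Subgroup.closure ({D.g, D.x} : Set G) := by
  intro h
  apply D.s_notMem_closure_gx
  have h1 : (D.g ^ i)⁻¹ * (D.g ^ i * D.s * D.x ^ e) * (D.x ^ e)⁻¹ ∈ Subgroup.closure ({D.g, D.x} : Set G) :=
    mul_mem (mul_mem (inv_mem (Subgroup.pow_mem _ (Subgroup.subset_closure (by simp)) i)) h)
      (inv_mem (Subgroup.pow_mem _ (Subgroup.subset_closure (by simp)) e))
  simpa only [mul_assoc, inv_mul_cancel_left, mul_inv_cancel, mul_one] using h1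

/-- **THE DIHEDRAL CORE CARRIES A DIHEDRAL DATUM** at level `n` with central rotation `c` (gen 48ʼs `Dihedral.Datum`: rotation `g`, reflection `x`,
rotations of index two, every non-rotation an involution `(gⁱ x)² = 1`). [folklore] -/
theorem nonempty_dihedralDatum :
    Nonempty (Dihedral.Datum (Subgroup.closure ({D.g, D.x} : Set G)) ⟨c, D.c_mem_closure_gx⟩ n) := by
  classical
  set K := Subgroup.closure ({D.g, D.x} : Set G) with hK
  have hg : D.g ∈ K := Subgroup.subset_closure (by simp)
  have hx : D.x ∈ K := Subgroup.subset_closure (by simp)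
  let g' : K := ⟨D.g, hg⟩
  let x' : K := ⟨D.x, hx⟩
  have hord' : orderOf g' = 2 * n := by rw [Subgroup.orderOf_mk, D.hord]
  -- elements of `zpowers g'` are powers of `g`
  have hzp : ∀ y : K, y ∈ Subgroup.zpowers g' → (y : G) ∈ Subgroup.zpowers D.g := fun y hy => by
    obtain ⟨k, hk⟩ := Subgroup.mem_zpowers_iff.mp hy
    rw [← hk]
    simp only [SubgroupClass.coe_zpow, g']
    exact Subgroup.zpow_mem _ (Subgroup.mem_zpowers _) k
  have hindex' : (Subgroup.zpowers g').index = 2 := by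
    have h := (Subgroup.zpowers g').card_mul_index
    rw [Nat.card_zpowers, hord', D.card_closure_gx] at h
    have hn : 0 < n := Nat.pos_of_ne_zero (fun h0 => by
      have := D.card_eq_eight_mul; rw [h0, mul_zero] at this; exact Fintype.card_ne_zero this)
    have : 2 * n * (Subgroup.zpowers g').index = 2 * n * 2 := by rw [h]; ring
    exact Nat.eq_of_mul_eq_mul_left (by omega) this
  refine ⟨{ g := g', s := x', hgn := ?_, hord := hord', hindex := hindex', hs := ?_, hinvol := ?_ }⟩
  · exact Subtype.ext (by simp only [SubgroupClass.coe_pow, g', D.hgn])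
  · exact fun h => D.x_notMem_zpowers_g (hzp x' h)
  · rintro ⟨y, hy⟩ hys
    obtain ⟨i, -, e, he, rfl⟩ := (D.mem_closure_gx_iff y).mp hy
    obtain rfl | rfl : e = 0 ∨ e = 1 := by omega
    · exact absurd (Subgroup.mem_zpowers_iff.mpr ⟨(i : ℤ), Subtype.ext (by simp [g'])⟩) hys
    · refine Subtype.ext ?_
      simp only [Subgroup.coe_mul, Subgroup.coe_one, pow_one]
      exact D.pow_mul_x_mul_self i

/-! ## §2 The abelian core `⟨g, s⟩` -/

omit [DecidableEq G] in
/-- **Membership in the abelian core**: `y ∈ ⟨g, s⟩ ↔ y = gⁱ sʲ` (`i < 2n`, `j < 2`). [folklore] -/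
theorem mem_closure_gs_iff (y : G) :
    y ∈ Subgroup.closure ({D.g, D.s} : Set G) ↔ ∃ i : ℕ, i < 2 * n ∧ ∃ j : ℕ, j < 2 ∧ y = D.g ^ i * D.s ^ j := by
  constructor
  · intro hy
    let K : Subgroup G :=
      { carrier := {y | ∃ z : ℤ, ∃ j : ℕ, j < 2 ∧ y = D.g ^ z * D.s ^ j}
        one_mem' := ⟨0, 0, by norm_num, by rw [zpow_zero, pow_zero, mul_one]⟩
        mul_mem' := by
          rintro _ _ ⟨z₁, j₁, hj₁, rfl⟩ ⟨z₂, j₂, hj₂, rfl⟩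
          refine ⟨z₁ + z₂, (j₁ + j₂) % 2, Nat.mod_lt _ two_pos, ?_⟩
          have hc : D.s ^ j₁ * D.g ^ z₂ = D.g ^ z₂ * D.s ^ j₁ := ((D.commute_g_s.zpow_left z₂).pow_right j₁).eq.symm
          rw [mul_assoc, ← mul_assoc (D.s ^ j₁), hc, mul_assoc, ← pow_add, ← D.s_pow_eq_pow_mod, ← mul_assoc, ← zpow_add]
        inv_mem' := by
          rintro _ ⟨z, j, hj, rfl⟩
          refine ⟨-z, j, hj, ?_⟩
          have hsinv : (D.s ^ j)⁻¹ = D.s ^ j := by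
            rw [← inv_pow, inv_eq_of_mul_eq_one_right D.hs2]
          rw [mul_inv_rev, hsinv, zpow_neg, ((D.commute_g_s.zpow_left z).pow_right j).inv_left.eq] }
    have hle : Subgroup.closure ({D.g, D.s} : Set G) ≤ K := by
      rw [Subgroup.closure_le]
      rintro y (rfl | rfl)
      · exact ⟨1, 0, by norm_num, by rw [zpow_one, pow_zero, mul_one]⟩
      · exact ⟨0, 1, by norm_num, by rw [zpow_zero, pow_one, one_mul]⟩
    obtain ⟨z, j, hj, rfl⟩ := hle hy
    obtain ⟨i, hi, h⟩ := D.exists_pow_eq_zpow z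
    exact ⟨i, hi, j, hj, by rw [h]⟩
  · rintro ⟨i, -, j, -, rfl⟩
    exact mul_mem (Subgroup.pow_mem _ (Subgroup.subset_closure (by simp)) i)
      (Subgroup.pow_mem _ (Subgroup.subset_closure (by simp)) j)

/-- **`|⟨g, s⟩| = 4n`.** [folklore] -/
theorem card_closure_gs : Nat.card (Subgroup.closure ({D.g, D.s} : Set G)) = 4 * n := by
  classical
  set K := Subgroup.closure ({D.g, D.s} : Set G)
  let f : Fin (2 * n) × Fin 2 → G := fun t => D.g ^ (t.1 : ℕ) * D.s ^ (t.2 : ℕ)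
  have hinj : Function.Injective f := by
    rintro ⟨i, j⟩ ⟨i', j'⟩ h
    obtain ⟨h1, h2⟩ := D.pow_spow_inj i.2 i'.2 j.2 j'.2 h
    ext <;> simp only [h1, h2]
  have himg : Finset.univ.filter (fun y : G => y ∈ K) = Finset.univ.image f := by
    ext y
    simp only [Finset.mem_filter, Finset.mem_univ, true_and, Finset.mem_image]
    rw [D.mem_closure_gs_iff]
    constructor
    · rintro ⟨i, hi, j, hj, rfl⟩; exact ⟨(⟨i, hi⟩, ⟨j, hj⟩), rfl⟩
    · rintro ⟨⟨i, j⟩, rfl⟩; exact ⟨i, i.2, j, j.2, rfl⟩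
  rw [Nat.card_eq_fintype_card, Fintype.card_subtype, himg, Finset.card_image_of_injective _ hinj, Finset.card_univ,
    Fintype.card_prod, Fintype.card_fin, Fintype.card_fin]
  ring

/-- **`⟨g, s⟩` has index two.** [folklore] -/
theorem index_closure_gs : (Subgroup.closure ({D.g, D.s} : Set G)).index = 2 := by
  have h := (Subgroup.closure ({D.g, D.s} : Set G)).card_mul_index
  rw [D.card_closure_gs, D.hcard] at h
  have : 4 * n * (Subgroup.closure ({D.g, D.s} : Set G)).index = 4 * n * 2 := by rw [h]; ring
  refine Nat.eq_of_mul_eq_mul_left ?_ this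
  have := Fintype.card_pos (α := G)
  have := D.card_eq_eight_mul
  omega

omit [Fintype G] [DecidableEq G] in
/-- **The abelian core is commutative.** [folklore] -/
theorem comm_of_mem_closure_gs {a b : G} (ha : a ∈ Subgroup.closure ({D.g, D.s} : Set G))
    (hb : b ∈ Subgroup.closure ({D.g, D.s} : Set G)) : a * b = b * a := by
  refine Subgroup.closure_induction (p := fun a _ => a * b = b * a) ?_ ?_ ?_ ?_ ha
  · rintro y (rfl | rfl)
    · refine Subgroup.closure_induction (p := fun b _ => D.g * b = b * D.g) ?_ ?_ ?_ ?_ hb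
      · rintro z (rfl | rfl)
        · rfl
        · exact D.hgs
      · rw [mul_one, one_mul]
      · intro u v _ _ hu hv; rw [← mul_assoc, hu, mul_assoc, hv, mul_assoc]
      · intro u _ hu
        rw [mul_inv_eq_iff_eq_mul, mul_assoc, hu, inv_mul_cancel_left]
    · refine Subgroup.closure_induction (p := fun b _ => D.s * b = b * D.s) ?_ ?_ ?_ ?_ hb
      · rintro z (rfl | rfl)
        · exact D.hgs.symm
        · rfl
      · rw [mul_one, one_mul]
      · intro u v _ _ hu hv; rw [← mul_assoc, hu, mul_assoc, hv, mul_assoc]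
      · intro u _ hu
        rw [mul_inv_eq_iff_eq_mul, mul_assoc, hu, inv_mul_cancel_left]
  · rw [one_mul, mul_one]
  · intro u v _ _ hu hv; rw [mul_assoc, hv, ← mul_assoc, hu, mul_assoc]
  · intro u _ hu
    rw [inv_mul_eq_iff_eq_mul, ← mul_assoc, hu, mul_inv_cancel_right]

omit [Fintype G] [DecidableEq G] in
/-- `c ∈ ⟨g, s⟩`. [folklore] -/
theorem c_mem_closure_gs : c ∈ Subgroup.closure ({D.g, D.s} : Set G) := by
  have h : D.g ^ n ∈ Subgroup.closure ({D.g, D.s} : Set G) := Subgroup.pow_mem _ (Subgroup.subset_closure (by simp)) n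
  rwa [D.hgn] at h

omit [DecidableEq G] in
/-- **`x ∉ ⟨g, s⟩`.** [folklore] -/
theorem x_notMem_closure_gs : D.x ∉ Subgroup.closure ({D.g, D.s} : Set G) := by
  rw [D.mem_closure_gs_iff]
  rintro ⟨i, -, j, -, h⟩
  exact D.hx i j h

end Datum

end

end Summit.HodgeConjecture.CorCM.Census.ShearedDihedral
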